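import Mathlib
import Summits.Ventures.PercRepro2.CrossAPrimeFreeEdge

/-!
# Flipping an edge at an isolated vertex, and the three-edge pinning
(blind cell PercRepro2, p5 g36; S4 §2.4 (s) addendum 38 (4); tools for `CrossAPrimeThreeRoutesBlob`)

A vertex `z` all of whose edges are closed is connected to nothing else
(`eq_of_conn_of_isolated`), so opening one edge at it does not change any connection among the
other vertices (`conn_update_true_iff_of_isolated`); for a measure whose other edges at `z` are
null, the probabilities of such flip-invariant events agree under `p[e ↦ 1]` and `p[e ↦ 0]`
(`prob_update_one_eq_update_zero_of_isolated`).  `prob_pin_three` is the eight-term expansion of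
a probability along three distinct pinned edges.  Own work; standard axioms.
-/

namespace Summit.Ventures.PercRepro2

open LeafRowPendantRootSO CrossAPrimeA2Route CrossAPrimeSupport CrossAPrimeTwoRoutes
  CrossAPrimeTwoRoutesSupp CrossAPrimeAvoidCrux CrossAPrimeFreeEdge

namespace CrossAPrimeIsolatedFlip

section Isolated

variable {V : Type*} {E : Type*} [DecidableEq E] {ends : E → Sym2 V}

omit [DecidableEq E] in
/-- An isolated vertex (all its edges closed) is connected to nothing else. -/
lemma eq_of_conn_of_isolated {ω : Config E} {z : V} (hiso : ∀ e, z ∈ ends e → ω e = false)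
    {x : V} (h : Conn ends ω z x) : x = z := by
  have key : x ∈ ({z} : Set V) := by
    refine mem_of_conn_of_closed (ends := ends) (ω := ω) (S := {z}) ?_ (Set.mem_singleton z) h
    intro a ha y hadj
    rw [Set.mem_singleton_iff] at ha
    subst ha
    obtain ⟨-, e, hopen, hends⟩ := openGraph_adj.1 hadj
    have hz : a ∈ ends e := by rw [hends]; exact Sym2.mem_mk_left a y
    rw [hiso e hz] at hopen
    exact absurd hopen Bool.false_ne_true
  exact Set.mem_singleton_iff.1 key

/-- **Flipping an edge at an isolated vertex** `z` does not change the connections among the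
other vertices. -/
lemma conn_update_true_iff_of_isolated {e : E} {t z : V} (hends : ends e = s(t, z))
    {ω : Config E} (hiso : ∀ e', z ∈ ends e' → ω e' = false) {x y : V} (hx : x ≠ z)
    (hy : y ≠ z) :
    Conn ends (Function.update ω e true) x y ↔ Conn ends ω x y := by
  rw [OneEdge.conn_update_true_iff hends ω x y]
  constructor
  · rintro (h | ⟨-, h⟩ | ⟨h, -⟩)
    · exact h
    · exact absurd (eq_of_conn_of_isolated hiso h) hy
    · exact absurd (eq_of_conn_of_isolated hiso (conn_symm h)) hx
  · exact Or.inl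

/-- The six masses' events are flip-invariant at an isolated vertex `z` off the marks. -/
lemma flip_iff_of_isolated {e : E} {t z : V} (hends : ends e = s(t, z)) {ω : Config E}
    (hiso : ∀ e', z ∈ ends e' → ω e' = false) {o a₁ a₂ v b : V} (hza₁ : a₁ ≠ z) (hza₂ : a₂ ≠ z)
    (hzo : o ≠ z) (hzb : b ≠ z) (hzv : v ≠ z) :
    (Function.update ω e true ∈ avoidAll ends a₂ {a₁} ↔ ω ∈ avoidAll ends a₂ {a₁}) ∧
      (Function.update ω e true ∈ connEvent ends a₂ o ↔ ω ∈ connEvent ends a₂ o) ∧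
      (Function.update ω e true ∈ connEvent ends a₂ b ↔ ω ∈ connEvent ends a₂ b) ∧
      (Function.update ω e true ∈ connEvent ends a₁ v ↔ ω ∈ connEvent ends a₁ v) ∧
      (Function.update ω e true ∈ connEvent ends a₂ v ↔ ω ∈ connEvent ends a₂ v) := by
  refine ⟨?_, ?_, ?_, ?_, ?_⟩
  · simp only [avoidAll, Set.mem_setOf_eq, Finset.mem_singleton, forall_eq]
    rw [conn_update_true_iff_of_isolated hends hiso hza₂ hza₁]
  · exact conn_update_true_iff_of_isolated hends hiso hza₂ hzo
  · exact conn_update_true_iff_of_isolated hends hiso hza₂ hzb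
  · exact conn_update_true_iff_of_isolated hends hiso hza₁ hzv
  · exact conn_update_true_iff_of_isolated hends hiso hza₂ hzv

end Isolated

section Flip

variable {V : Type*} {E : Type*} [Fintype E] [DecidableEq E] {R : Type*} [Field R]
variable {ends : E → Sym2 V}

/-- **Flipping an edge at a vertex `z` whose other edges are null**: the probabilities of
flip-invariant events agree under `p[e ↦ 1]` and `p[e ↦ 0]`. -/
lemma prob_update_one_eq_update_zero_of_isolated (p : E → R) {e : E} {z : V}
    (hz : ∀ e', z ∈ ends e' → e' ≠ e → p e' = 0) {S : Set (Config E)}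
    (hS : ∀ ω : Config E, (∀ e', z ∈ ends e' → ω e' = false) →
      (Function.update ω e true ∈ S ↔ ω ∈ S)) :
    prob (Function.update p e 1) S = prob (Function.update p e 0) S := by
  rw [RBRootEdge.prob_update_one_eq, RBRootEdge.prob_update_zero_eq]
  apply prob_congr_supp
  ext ω
  simp only [Set.mem_inter_iff, Set.mem_setOf_eq]
  constructor
  · rintro ⟨h, hs⟩
    refine ⟨?_, hs⟩
    have hiso : ∀ e', z ∈ ends e' → Function.update ω e false e' = false := by
      intro e' hz'
      by_cases he' : e' = e
      · subst he'; simp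
      · rw [Function.update_of_ne he']
        exact (hs e').2 (hz e' hz' he')
    have := hS _ hiso
    rw [Function.update_idem] at this
    exact this.1 h
  · rintro ⟨h, hs⟩
    refine ⟨?_, hs⟩
    have hiso : ∀ e', z ∈ ends e' → Function.update ω e false e' = false := by
      intro e' hz'
      by_cases he' : e' = e
      · subst he'; simp
      · rw [Function.update_of_ne he']
        exact (hs e').2 (hz e' hz' he')
    have := hS _ hiso
    rw [Function.update_idem] at this
    exact this.2 h

end Flip

section Pins

variable {E : Type*} [Fintype E] [DecidableEq E] {R : Type*} [Field R]

/-- Pinning three distinct edges: the eight-term expansion of a probability. -/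
lemma prob_pin_three (p : E → R) (X : Set (Config E)) {e₁ e₂ e₃ : E} (h₁₂ : e₁ ≠ e₂)
    (h₁₃ : e₁ ≠ e₃) (h₂₃ : e₂ ≠ e₃) :
    prob p X =
      p e₁ * p e₂ * p e₃ *
          prob (Function.update (Function.update (Function.update p e₁ 1) e₂ 1) e₃ 1) X +
        p e₁ * p e₂ * (1 - p e₃) *
          prob (Function.update (Function.update (Function.update p e₁ 1) e₂ 1) e₃ 0) X +
        p e₁ * (1 - p e₂) * p e₃ *
          prob (Function.update (Function.update (Function.update p e₁ 1) e₂ 0) e₃ 1) X +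
        p e₁ * (1 - p e₂) * (1 - p e₃) *
          prob (Function.update (Function.update (Function.update p e₁ 1) e₂ 0) e₃ 0) X +
        (1 - p e₁) * p e₂ * p e₃ *
          prob (Function.update (Function.update (Function.update p e₁ 0) e₂ 1) e₃ 1) X +
        (1 - p e₁) * p e₂ * (1 - p e₃) *
          prob (Function.update (Function.update (Function.update p e₁ 0) e₂ 1) e₃ 0) X +
        (1 - p e₁) * (1 - p e₂) * p e₃ *
          prob (Function.update (Function.update (Function.update p e₁ 0) e₂ 0) e₃ 1) X +
        (1 - p e₁) * (1 - p e₂) * (1 - p e₃) *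
          prob (Function.update (Function.update (Function.update p e₁ 0) e₂ 0) e₃ 0) X := by
  rw [prob_eq_pin p X e₁, prob_eq_pin (Function.update p e₁ 1) X e₂,
    prob_eq_pin (Function.update p e₁ 0) X e₂,
    prob_eq_pin (Function.update (Function.update p e₁ 1) e₂ 1) X e₃,
    prob_eq_pin (Function.update (Function.update p e₁ 1) e₂ 0) X e₃,
    prob_eq_pin (Function.update (Function.update p e₁ 0) e₂ 1) X e₃,
    prob_eq_pin (Function.update (Function.update p e₁ 0) e₂ 0) X e₃]
  simp only [Function.update_of_ne h₁₂.symm, Function.update_of_ne h₁₃.symm,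
    Function.update_of_ne h₂₃.symm]
  ring

end Pins

end CrossAPrimeIsolatedFlip

end Summit.Ventures.PercRepro2
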